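import Summits.QuantumFields.YangMills.Theorems.LuscherReductionTwistedTraceScalingBOStiffColour
import Summits.QuantumFields.YangMills.Theorems.LuscherReductionTwistedTraceScalingSlowDisintegrationTubes
import HarnessLib

/-!
# (B-ST) assembly step 4, second line: kernel forms of tube-supported functions in tube coordinates `(u, x) ∈ SU(2)³ × Bal`
# (lane A of S-BASE, crux `TwistedTraceScaling` stmt-QuantumFields-20203, C4-CORE, the (B-ST) pen; HANDOFF-g21 ASSEMBLY RECIPE step 4)

`integral_configMeasure_orthoTube` (✓ `…SlowDisintegrationTubes`) writes `∫ F dσ^{⊗E}` for `F` vanishing off the tube set as `∫_x ∫_u F(orthoTube u x) dσ³ dπ`, `π = orthoTransverse`.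
Here: ★ `integral_configMeasure_orthoTube_prod` — the same as ONE integral over `σ³ ⊗ π` in the pair variable `p = (u,x)`;
★★★ `kernelForm_eq_tube_integral` — for bounded measurable `f` vanishing off the tube set and a bounded jointly measurable kernel `F`,
`∫∫ f(U) F(U,V) f(V) dU dV = ∫_p ∫_q f(oT p) F(oT p, oT q) f(oT q) d(σ³⊗π) d(σ³⊗π)` — exactly the left side of `…BOStiffSlowAssembly.form_le_of_product_near`
(`(U,ν) = (SU(2)³, σ³)`, `(X,μ) = (Bal, π)`), to be used with `F =` the based kernel after `…BOStiffBasedForm.qform_basedAvg_eq_basedKernel_form`.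
HONEST FRAMING: bookkeeping for a stub of a child of the CONDITIONAL route R2b1; (B-ST) OPEN; C4-CORE OPEN; not infinite volume, not a gap, not Clay.
-/

set_option autoImplicit false

noncomputable section

open MeasureTheory

namespace Summit.QuantumFields.YangMills.Theorems.FemtoTransferGap.TwoLattice.ConstTube

open Literature.MathematicalPhysics.QuantumFieldTheory Literature.MathematicalPhysics.QuantumLattice TwoLattice.Avg

variable {L : ℕ} [NeZero L]

/-- ★ **Tube disintegration in the pair variable**: for bounded measurable `F` vanishing off the tube set,
`∫ F dσ^{⊗E} = ∫ F(orthoTube p.1 p.2) d(σ³ ⊗ π)(p)`. [folklore] -/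
theorem integral_configMeasure_orthoTube_prod {F : GaugeConfig 3 L SU2 → ℝ} (hF : Measurable F) (hb : ∃ C : ℝ, ∀ U, |F U| ≤ C)
    (h0 : ∀ U, U ∉ orthoTubeSet L → F U = 0) :
    ∫ U, F U ∂configMeasure SU2 L = ∫ p, F (orthoTube L p.1 p.2) ∂(configMeasure SU2 1).prod (orthoTransverse L) := by
  haveI := isFiniteMeasure_orthoTransverse L
  rw [integral_configMeasure_orthoTube L hF hb h0]
  have hm : Measurable fun p : GaugeConfig 3 1 SU2 × (Edge 3 L → Fin 3 → ℝ) => F (orthoTube L p.1 p.2) := hF.comp (measurable_orthoTube L)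
  obtain ⟨C, hC⟩ := hb
  have hint : Integrable (fun p : GaugeConfig 3 1 SU2 × (Edge 3 L → Fin 3 → ℝ) => F (orthoTube L p.1 p.2)) ((configMeasure SU2 1).prod (orthoTransverse L)) :=
    integrable_of_measurable_abs_le _ hm (C := C) fun p => hC _
  rw [integral_prod _ hint]
  exact (integral_integral_swap hint).symm

/-- The partial kernel integral `U ↦ ∫ f(U) F(U,V) f(V) dV` is measurable, bounded, and vanishes where `f` does. [folklore] -/
theorem kernelForm_inner_props {f : GaugeConfig 3 L SU2 → ℝ} (hf : Measurable f) {Cf : ℝ} (hCf : ∀ U, |f U| ≤ Cf)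
    {F : GaugeConfig 3 L SU2 → GaugeConfig 3 L SU2 → ℝ} (hFm : Measurable (Function.uncurry F)) {CF : ℝ} (hFb : ∀ U V, |F U V| ≤ CF) :
    Measurable (fun U => ∫ V, f U * F U V * f V ∂configMeasure SU2 L) ∧ (∀ U, |∫ V, f U * F U V * f V ∂configMeasure SU2 L| ≤ Cf * CF * Cf) ∧
      ∀ U, f U = 0 → (∫ V, f U * F U V * f V ∂configMeasure SU2 L) = 0 := by
  have hCf0 : 0 ≤ Cf := (abs_nonneg _).trans (hCf 1)
  have hCF0 : 0 ≤ CF := (abs_nonneg _).trans (hFb 1 1)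
  have hJ : Measurable fun p : GaugeConfig 3 L SU2 × GaugeConfig 3 L SU2 => f p.1 * F p.1 p.2 * f p.2 := ((hf.comp measurable_fst).mul hFm).mul (hf.comp measurable_snd)
  refine ⟨(hJ.stronglyMeasurable.integral_prod_right' (ν := configMeasure SU2 L)).measurable, fun U => ?_, fun U hU => ?_⟩
  · have h := norm_integral_le_of_norm_le_const (μ := configMeasure SU2 L) (f := fun V => f U * F U V * f V) (C := Cf * CF * Cf)
      (Filter.Eventually.of_forall fun V => by
        rw [Real.norm_eq_abs, abs_mul, abs_mul]
        exact mul_le_mul (mul_le_mul (hCf _) (hFb _ _) (abs_nonneg _) hCf0) (hCf _) (abs_nonneg _) (mul_nonneg hCf0 hCF0))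
    rw [Real.norm_eq_abs] at h
    simpa [Measure.real] using h
  · simp [hU]

/-- ★★★ **Kernel form in tube coordinates**: for bounded measurable `f` vanishing off the tube set and a bounded jointly measurable kernel `F`,
`∫∫ f(U) F(U,V) f(V) dU dV = ∫_p ∫_q f(orthoTube p) F(orthoTube p, orthoTube q) f(orthoTube q) d(σ³⊗π)(p) d(σ³⊗π)(q)`. [folklore] -/
theorem kernelForm_eq_tube_integral {f : GaugeConfig 3 L SU2 → ℝ} (hf : Measurable f) {Cf : ℝ} (hCf : ∀ U, |f U| ≤ Cf) (h0 : ∀ U, U ∉ orthoTubeSet L → f U = 0)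
    {F : GaugeConfig 3 L SU2 → GaugeConfig 3 L SU2 → ℝ} (hFm : Measurable (Function.uncurry F)) {CF : ℝ} (hFb : ∀ U V, |F U V| ≤ CF) :
    ∫ U, ∫ V, f U * F U V * f V ∂configMeasure SU2 L ∂configMeasure SU2 L =
      ∫ p, ∫ q, f (orthoTube L p.1 p.2) * F (orthoTube L p.1 p.2) (orthoTube L q.1 q.2) * f (orthoTube L q.1 q.2)
        ∂(configMeasure SU2 1).prod (orthoTransverse L) ∂(configMeasure SU2 1).prod (orthoTransverse L) := by
  obtain ⟨hIm, hIb, hI0⟩ := kernelForm_inner_props (L := L) hf hCf hFm hFb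
  -- outer variable
  rw [integral_configMeasure_orthoTube_prod hIm ⟨_, hIb⟩ fun U hU => hI0 U (h0 U hU)]
  refine integral_congr_ae (ae_of_all _ fun p => ?_)
  dsimp only
  -- inner variable, at the tube point `orthoTube p`
  have hm : Measurable fun V => f (orthoTube L p.1 p.2) * F (orthoTube L p.1 p.2) V * f V :=
    (measurable_const.mul (hFm.comp (measurable_const.prodMk measurable_id))).mul hf
  have hCf0 : 0 ≤ Cf := (abs_nonneg _).trans (hCf 1)
  have hb : ∃ C : ℝ, ∀ V, |f (orthoTube L p.1 p.2) * F (orthoTube L p.1 p.2) V * f V| ≤ C :=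
    ⟨Cf * CF * Cf, fun V => by
      rw [abs_mul, abs_mul]
      exact mul_le_mul (mul_le_mul (hCf _) (hFb _ _) (abs_nonneg _) hCf0) (hCf _) (abs_nonneg _) (mul_nonneg hCf0 ((abs_nonneg _).trans (hFb 1 1)))⟩
  exact integral_configMeasure_orthoTube_prod hm hb fun V hV => by rw [h0 V hV, mul_zero]

end Summit.QuantumFields.YangMills.Theorems.FemtoTransferGap.TwoLattice.ConstTube

end
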